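import Mathlib
import Summits.NavierStokesRegularity.NavierStokesRegularity.Theorems.EulerZoomLiouvillePowerGaugeEulerLiouvilleSelfSimilarSaddleContinuumBadSet
import Literature.Analysis.FluidPDE.SelfSimilarEulerStagnationStretching
import HarnessLib

/-!
# Rung C1 of the crux `EulerZoomLiouville.PowerGaugeEulerLiouville`: thin nodes with a CONTRACTING PLANE, and the
# saddle-continuum exclusion for EITHER block shape (route №10, item stmt-NavierStokesRegularity-19832; `--supports`)

Helper file (theorems only). Seat ns-typeII-p3 (cell ns-regularity-ideate §B, D-0081).  Sequel to
`…SelfSimilarSaddleContinuum(BadSet)`.  There the «thin» shape of a bad node was a dominated contracting LINE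
(`d₂ < 0`, `d₂ < d₀`, `d₂ < d₁`).  The spectral census of bad nodes of an in-window profile (`tr DW = 3γ`, one
eigenvalue `≥ 1 + γ` or exactly `1 + γ` at a vortical node, so the two others have real parts summing to
`≤ 2γ − 1 < 0`) produces a second shape: a contracting PLANE dominated by a line — two negative rates `d₀, d₁`
(a complex pair `d₀ = d₁ = Re λ < 0`, or a repeated negative real eigenvalue) below `d₂` (`= 1 + γ` at a vortical node).
This file adds that shape and re-assembles:

* `volume_setOf_tendsto_flow_atBot_mem_eq_zero_of_trappedSets` — the COVER ARGUMENT isolated: if every point of a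
  compact `Kset` has a sampling time and a radius with a NULL trapped set, the set of points converging backward into
  `Kset` is null;
* `exists_trappedSet_null_of_contractingPlane` — block form with `d₀ < 0`, `d₁ < 0`, `d₀ < d₂`, `d₁ < d₂`
  (`Es = span{b₀,b₁}` dominated by `Ec = span{b₂}`) ⇒ null trapped set;
* **`volume_setOf_tendsto_flow_atBot_mem_eq_zero_of_thinBlock`** — `Kset ⊆ 𝒩_W` compact, at each point a real block
  form of EITHER shape (contracting line dominated by the plane, or contracting plane dominated by the line) ⇒ the set
  of points converging backward into `Kset` is null;
* **`eq_zero_of_driftCoordinate_of_thinBlock_on_badSet`** — the exclusion theorem with either shape at every bad node: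
  `0 < γ < ½`, `V` smooth, (3.8), `C¹` drift coordinate on an open `U ⊇ 𝒩_W` injective on `𝒩_W` ⇒ `V ≡ 0`.  With the
  two shapes, hypothesis (ii) holds at every bad node whose linearisation is SEMISIMPLE (real-diagonalisable, or one
  real eigenvalue plus a complex pair): the classical residue of rung C1 is reduced to DRIFT along stagnation continua
  (no drift coordinate) and defective linearisations.

WHAT THIS IS NOT: not NS, not E, not rung C1 — the block data and the drift coordinate are HYPOTHESES.
[folklore; cf. Robinson1999 Ch. V §5.10.1; ConstantinIgnatovaVicol2026Putative §3.5]
-/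

noncomputable section

-- flat `Theorems/<Route><Decl>…` files of one crux share the namespace of the crux (tree convention)
set_option linter.dupNamespace false

open MeasureTheory Set Filter Topology Metric Function InnerProductSpace
open scoped RealInnerProductSpace NNReal ContDiff

namespace Summit.NavierStokesRegularity.NavierStokesRegularity.Theorems.PowerGaugeEulerLiouville.Kelvin

open Literature.Analysis Literature.Analysis.FluidPDE Literature.Dynamics.FixedPoints

variable {γ : ℝ} {V : EuclideanSpace ℝ (Fin 3) → EuclideanSpace ℝ (Fin 3)} {P : EuclideanSpace ℝ (Fin 3) → ℝ}

/-! ### The cover argument, isolated -/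

/-- **Cover argument.**  `V` smooth with `‖DV‖ ≤ K`, `Kset` compact; if every `z ∈ Kset` has a sampling time `T > 0`
and a radius `r > 0` such that the set of points admitting a `Φ_T`-past history inside `B(z, r)` is null, then the set
of points whose backward trajectory converges to some point of `Kset` is null (finite sub-cover by half-balls, integer
sampling, `C¹` images of null sets). [folklore] -/
theorem volume_setOf_tendsto_flow_atBot_mem_eq_zero_of_trappedSets (hV : ContDiff ℝ ∞ V) {K : ℝ}
    (hK : ∀ y, ‖fderiv ℝ V y‖ ≤ K) {Kset : Set (EuclideanSpace ℝ (Fin 3))} (hKc : IsCompact Kset)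
    (hdata : ∀ z ∈ Kset, ∃ T : ℝ, 0 < T ∧ ∃ r : ℝ, 0 < r ∧ volume {q : EuclideanSpace ℝ (Fin 3) |
      ∃ qs : ℕ → EuclideanSpace ℝ (Fin 3), qs 0 = q ∧
        (∀ k, ODE.evolutionMap (fun _ : ℝ => selfSimilarTransport γ 0 V) 0 T (qs (k + 1)) = qs k) ∧
        ∀ k, qs k ∈ ball z r} = 0) :
    volume {x : EuclideanSpace ℝ (Fin 3) | ∃ z ∈ Kset,
      Tendsto (fun s => ODE.evolutionMap (fun _ : ℝ => selfSimilarTransport γ 0 V) 0 s x) atBot (𝓝 z)} = 0 := by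
  set Φ := ODE.evolutionMap (fun _ : ℝ => selfSimilarTransport γ 0 V) 0 with hΦ
  choose! T hT r hr hnull using hdata
  obtain ⟨t, htK, hcover⟩ := hKc.elim_nhds_subcover (fun z => ball z (r z / 2))
    (fun z hz => ball_mem_nhds z (half_pos (hr z hz)))
  have hWnull : ∀ i ∈ t, ∀ n : ℕ, volume ((Φ (T i))^[n] '' {q : EuclideanSpace ℝ (Fin 3) |
      ∃ qs : ℕ → EuclideanSpace ℝ (Fin 3), qs 0 = q ∧ (∀ k, Φ (T i) (qs (k + 1)) = qs k) ∧
        ∀ k, qs k ∈ ball i (r i)}) = 0 := by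
    intro i hi n
    have hFd : Differentiable ℝ (Φ (T i)) := (contDiff_flow (γ := γ) hV hK (T i)).differentiable (by simp)
    exact addHaar_image_eq_zero_of_differentiableOn_of_addHaar_eq_zero volume (hFd.iterate n).differentiableOn
      (hnull i (htK i hi))
  refine measure_mono_null (fun x hx => ?_)
    ((measure_biUnion_null_iff t.countable_toSet).2 fun i hi => measure_iUnion_null (hWnull i hi))
  obtain ⟨z, hzK, hz⟩ := hx
  obtain ⟨i, hi, hzi⟩ := mem_iUnion₂.1 (hcover hzK)
  have hri : 0 < r i := hr i (htK i hi)
  have hsub : ball z (r i / 2) ⊆ ball i (r i) := by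
    intro y hy
    rw [mem_ball] at hy hzi ⊢
    calc dist y i ≤ dist y z + dist z i := dist_triangle _ _ _
      _ < r i / 2 + r i / 2 := add_lt_add hy hzi
      _ = r i := by ring
  have hev : ∀ᶠ s in atBot, Φ s x ∈ ball i (r i) :=
    (hz.eventually (ball_mem_nhds z (half_pos hri))).mono fun s hs => hsub hs
  obtain ⟨S, hS⟩ := eventually_atBot.1 hev
  obtain ⟨n, hn⟩ := exists_nat_ge (-S / T i)
  have hTi : 0 < T i := hT i (htK i hi)
  have hnS : -((n : ℝ) * T i) ≤ S := by
    have := (div_le_iff₀ hTi).1 hn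
    linarith
  refine mem_iUnion₂.2 ⟨i, hi, mem_iUnion.2 ⟨n, ?_⟩⟩
  have hmem : Φ (-((n : ℝ) * T i)) x ∈ {q : EuclideanSpace ℝ (Fin 3) |
      ∃ qs : ℕ → EuclideanSpace ℝ (Fin 3), qs 0 = q ∧ (∀ k, Φ (T i) (qs (k + 1)) = qs k) ∧
        ∀ k, qs k ∈ ball i (r i)} := by
    refine ⟨fun k => Φ (-(((n : ℝ) + k) * T i)) x, by simp, fun k => ?_, fun k => hS _ ?_⟩
    · show Φ (T i) (Φ (-(((n : ℝ) + ((k + 1 : ℕ) : ℝ)) * T i)) x) = Φ (-(((n : ℝ) + k) * T i)) x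
      rw [hΦ, ← flow_add (γ := γ) hV hK]
      congr 1; push_cast; ring
    · have hk : (0 : ℝ) ≤ k := Nat.cast_nonneg k
      nlinarith
  refine ⟨Φ (-((n : ℝ) * T i)) x, hmem, ?_⟩
  rw [hΦ, iterate_flow_eq hV hK, ← flow_add (γ := γ) hV hK, add_neg_cancel]
  exact flow_zero x

/-! ### A contracting plane dominated by a line gives a null trapped set -/

/-- **Null trapped set at a node with a dominated contracting PLANE.**  `V` smooth with `‖DV‖ ≤ K`, `z ∈ 𝒩_W`, and
`DW(z)` in real block form `A b₀ = d₀b₀ − βb₁`, `A b₁ = βb₀ + d₁b₁`, `A b₂ = d₂b₂` with `d₀ < 0`, `d₁ < 0`, `d₀ < d₂`,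
`d₁ < d₂` (a complex pair with negative real part, or two negative real rates, below the third rate).  Then for some
`T > 0`, `r > 0`, the set of points admitting a `Φ_T`-past history inside `B(z, r)` is null (`Es = span{b₀,b₁}`,
rate `≤ √(‖G‖/g₀)·e^{max(d₀,d₁)T} < 1`; `Ec = span{b₂}`, rate `e^{d₂T}`).
[cite: Robinson1999, Ch. V §5.10.1 (cone estimate, dominated form; proved in the tree)] -/
theorem exists_trappedSet_null_of_contractingPlane (hV : ContDiff ℝ ∞ V) {K : ℝ} (hK : ∀ y, ‖fderiv ℝ V y‖ ≤ K)
    {z : EuclideanSpace ℝ (Fin 3)} (hz : z ∈ selfSimilarNodalSet γ 0 V)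
    (b : Module.Basis (Fin 3) ℝ (EuclideanSpace ℝ (Fin 3))) (lam : Fin 3 → ℝ) (β : ℝ)
    (hA0 : (γ • ContinuousLinearMap.id ℝ (EuclideanSpace ℝ (Fin 3)) + fderiv ℝ V z) (b 0) = lam 0 • b 0 - β • b 1)
    (hA1 : (γ • ContinuousLinearMap.id ℝ (EuclideanSpace ℝ (Fin 3)) + fderiv ℝ V z) (b 1) = β • b 0 + lam 1 • b 1)
    (hA2 : (γ • ContinuousLinearMap.id ℝ (EuclideanSpace ℝ (Fin 3)) + fderiv ℝ V z) (b 2) = lam 2 • b 2)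
    (h0 : lam 0 < 0) (h1 : lam 1 < 0) (h02 : lam 0 < lam 2) (h12 : lam 1 < lam 2) :
    ∃ T : ℝ, 0 < T ∧ ∃ r : ℝ, 0 < r ∧ volume {q : EuclideanSpace ℝ (Fin 3) | ∃ qs : ℕ → EuclideanSpace ℝ (Fin 3),
      qs 0 = q ∧ (∀ k, ODE.evolutionMap (fun _ : ℝ => selfSimilarTransport γ 0 V) 0 T (qs (k + 1)) = qs k) ∧
        ∀ k, qs k ∈ ball z r} = 0 := by
  set A : EuclideanSpace ℝ (Fin 3) →L[ℝ] EuclideanSpace ℝ (Fin 3) :=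
    γ • ContinuousLinearMap.id ℝ (EuclideanSpace ℝ (Fin 3)) + fderiv ℝ V z with hA
  set Λ : ℝ := max (lam 0) (lam 1) with hΛ
  have hΛ0 : Λ < 0 := max_lt h0 h1
  have hΛ2 : Λ < lam 2 := max_lt h02 h12
  -- Lyapunov pair on the plane, with the UPPER bound `⟪GAh,h⟫ ≤ Λ⟪Gh,h⟫`
  obtain ⟨G, hGsym, ⟨g₀, hg₀, hGpos⟩, hGA⟩ := exists_adapted_on_span_pair A b lam β hA0 hA1
    (μ₀ := min (lam 0) (lam 1)) (Λ₀ := Λ) (min_le_left _ _) (min_le_right _ _) (le_max_left _ _) (le_max_right _ _)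
  have hGx : ∀ y, ⟪G y, y⟫ ≤ ‖G‖ * ‖y‖ ^ 2 := fun y => by
    calc ⟪G y, y⟫ ≤ ‖G y‖ * ‖y‖ := real_inner_le_norm _ _
      _ ≤ ‖G‖ * ‖y‖ * ‖y‖ := mul_le_mul_of_nonneg_right (G.le_opNorm y) (norm_nonneg _)
      _ = ‖G‖ * ‖y‖ ^ 2 := by ring
  have hGn : 0 < ‖G‖ := by
    have hb0 : b 0 ≠ 0 := b.ne_zero 0
    have h1' := hGpos (b 0)
    have h2' := hGx (b 0)
    have h3 : 0 < g₀ * ‖b 0‖ ^ 2 := mul_pos hg₀ (pow_pos (norm_pos_iff.2 hb0) 2)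
    by_contra hcon
    push Not at hcon
    have : ‖G‖ = 0 := le_antisymm hcon (norm_nonneg _)
    rw [this, zero_mul] at h2'
    linarith
  set c₀ : ℝ := Real.sqrt (‖G‖ / g₀) with hc₀
  have hc₀pos : 0 < c₀ := Real.sqrt_pos.2 (div_pos hGn hg₀)
  -- sampling time: `e^{κT} > c₀` with `κ = min (−Λ) (d₂ − Λ) > 0`
  set κ : ℝ := min (-Λ) (lam 2 - Λ) with hκ
  have hκ0 : 0 < κ := lt_min (by linarith) (by linarith)
  set T : ℝ := c₀ / κ + 1 with hTdef
  have hT0 : 0 < T := by rw [hTdef]; positivity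
  have hκT : c₀ < Real.exp (κ * T) := by
    have h2 : κ * T = c₀ + κ := by rw [hTdef]; field_simp
    have h3 := Real.add_one_le_exp (κ * T)
    rw [h2] at h3 ⊢
    linarith
  -- the rates
  set a : ℝ := c₀ * Real.exp (Λ * T) with ha
  have ha1 : a < 1 := by
    -- `c₀ e^{ΛT} < e^{κT} e^{ΛT} ≤ e^{−ΛT} e^{ΛT} = 1`
    have h1' : Real.exp (κ * T) ≤ Real.exp (-Λ * T) :=
      Real.exp_le_exp.2 (mul_le_mul_of_nonneg_right (min_le_left _ _) hT0.le)
    have h2' : Real.exp (-Λ * T) * Real.exp (Λ * T) = 1 := by rw [← Real.exp_add]; ring_nf; simp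
    calc a = c₀ * Real.exp (Λ * T) := rfl
      _ < Real.exp (κ * T) * Real.exp (Λ * T) := mul_lt_mul_of_pos_right hκT (Real.exp_pos _)
      _ ≤ Real.exp (-Λ * T) * Real.exp (Λ * T) := mul_le_mul_of_nonneg_right h1' (Real.exp_pos _).le
      _ = 1 := h2'
  have hab : a < Real.exp (lam 2 * T) := by
    have h1' : Real.exp (κ * T) ≤ Real.exp ((lam 2 - Λ) * T) :=
      Real.exp_le_exp.2 (mul_le_mul_of_nonneg_right (min_le_right _ _) hT0.le)
    have h2' : Real.exp ((lam 2 - Λ) * T) * Real.exp (Λ * T) = Real.exp (lam 2 * T) := by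
      rw [← Real.exp_add]; ring_nf
    calc a = c₀ * Real.exp (Λ * T) := rfl
      _ < Real.exp (κ * T) * Real.exp (Λ * T) := mul_lt_mul_of_pos_right hκT (Real.exp_pos _)
      _ ≤ Real.exp ((lam 2 - Λ) * T) * Real.exp (Λ * T) := mul_le_mul_of_nonneg_right h1' (Real.exp_pos _).le
      _ = Real.exp (lam 2 * T) := h2'
  have hexp := fderiv_flow_eq_exp_smul hV hK hz T
  have hF : ContDiff ℝ 1 (ODE.evolutionMap (fun _ : ℝ => selfSimilarTransport γ 0 V) 0 T) :=
    (contDiff_flow (γ := γ) hV hK T).of_le (by norm_cast)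
  -- upper rate on the plane
  have hplane : ∀ x ∈ Submodule.span ℝ ({b 0, b 1} : Set (EuclideanSpace ℝ (Fin 3))),
      ‖NormedSpace.exp (T • A) x‖ ≤ a * ‖x‖ := by
    intro x hx
    have hle : ∀ h ∈ Submodule.span ℝ ({b 0, b 1} : Set (EuclideanSpace ℝ (Fin 3))), ⟪G (A h), h⟫ ≤ -(-Λ) * ⟪G h, h⟫ :=
      fun h hh => by rw [neg_neg]; exact (hGA h hh).2
    have h := inner_exp_smul_apply_le A G (mapsTo_span_pair_of_blockBasis A b lam β hA0 hA1) hGsym hle hx hT0.le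
    set y := NormedSpace.exp (T • A) x with hy
    -- `g₀‖y‖² ≤ ⟪Gy,y⟫ ≤ e^{2ΛT}⟪Gx,x⟫ ≤ e^{2ΛT}‖G‖‖x‖²`
    have h1' : g₀ * ‖y‖ ^ 2 ≤ Real.exp (-(2 * -Λ) * T) * (‖G‖ * ‖x‖ ^ 2) :=
      (hGpos y).trans (h.trans (mul_le_mul_of_nonneg_left (hGx x) (Real.exp_pos _).le))
    have h2' : ‖y‖ ^ 2 ≤ (a * ‖x‖) ^ 2 := by
      rw [ha, mul_pow, mul_pow, hc₀, Real.sq_sqrt (div_pos hGn hg₀).le, ← Real.exp_nat_mul]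
      rw [div_mul_eq_mul_div, div_mul_eq_mul_div, le_div_iff₀ hg₀]
      calc ‖y‖ ^ 2 * g₀ = g₀ * ‖y‖ ^ 2 := by ring
        _ ≤ Real.exp (-(2 * -Λ) * T) * (‖G‖ * ‖x‖ ^ 2) := h1'
        _ = ‖G‖ * Real.exp (↑2 * (Λ * T)) * ‖x‖ ^ 2 := by ring_nf
    have ha0 : 0 ≤ a * ‖x‖ := by positivity
    exact (pow_le_pow_iff_left₀ (norm_nonneg _) ha0 two_ne_zero).1 h2'
  -- lower rate on the line
  have hline : ∀ x ∈ Submodule.span ℝ ({b 2} : Set (EuclideanSpace ℝ (Fin 3))),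
      Real.exp (lam 2 * T) * ‖x‖ ≤ ‖NormedSpace.exp (T • A) x‖ := by
    intro x hx
    have hge : ∀ h ∈ Submodule.span ℝ ({b 2} : Set (EuclideanSpace ℝ (Fin 3))),
        lam 2 * ⟪(ContinuousLinearMap.id ℝ _) h, h⟫ ≤ ⟪(ContinuousLinearMap.id ℝ _) (A h), h⟫ := by
      intro h hh
      rw [ContinuousLinearMap.id_apply, ContinuousLinearMap.id_apply,
        inner_apply_self_of_mem_span_singleton A b lam hA2 hh, real_inner_self_eq_norm_sq]
    have h := inner_exp_smul_apply_ge A (ContinuousLinearMap.id ℝ _) (mapsTo_span_singleton_of_blockBasis A b lam hA2)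
      (fun u v => by simp) hge hx hT0.le
    rw [ContinuousLinearMap.id_apply, ContinuousLinearMap.id_apply, real_inner_self_eq_norm_sq,
      real_inner_self_eq_norm_sq] at h
    have h2' : (Real.exp (lam 2 * T) * ‖x‖) ^ 2 ≤ ‖NormedSpace.exp (T • A) x‖ ^ 2 := by
      calc (Real.exp (lam 2 * T) * ‖x‖) ^ 2 = Real.exp (2 * lam 2 * T) * ‖x‖ ^ 2 := by
            rw [mul_pow, ← Real.exp_nat_mul]; ring_nf
        _ ≤ ‖NormedSpace.exp (T • A) x‖ ^ 2 := h
    exact (pow_le_pow_iff_left₀ (by positivity) (norm_nonneg _) two_ne_zero).1 h2'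
  obtain ⟨r, hr, hnull⟩ := hausdorffMeasure_localTrappedSet_eq_zero_of_dominated (p := z) hF
    (Es := Submodule.span ℝ {b 0, b 1}) (Ec := Submodule.span ℝ {b 2}) (isCompl_span_singleton_span_pair b).symm
    (fun x hx => by rw [hexp]; exact exp_smul_apply_mem A (mapsTo_span_pair_of_blockBasis A b lam β hA0 hA1) hx T)
    (fun x hx => by rw [hexp]; exact exp_smul_apply_mem A (mapsTo_span_singleton_of_blockBasis A b lam hA2) hx T)
    (a := a) (b := Real.exp (lam 2 * T)) ha1 hab
    (fun x hx => by rw [hexp]; exact hplane x hx)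
    (fun x hx => by rw [hexp]; exact hline x hx) (span_singleton_ne_top b)
  exact ⟨T, hT0, r, hr,
    (Measure.absolutelyContinuous_isAddHaarMeasure volume (μH[Module.finrank ℝ (EuclideanSpace ℝ (Fin 3))])) hnull⟩

/-! ### Assembly with either block shape -/

/-- **Orbits converging into a compact THIN-BLOCK piece of the stagnation set form a null set**: `Kset ⊆ 𝒩_W`
compact; at every `z ∈ Kset` a real block form of `DW(z)` with EITHER a dominated contracting line
(`d₂ < 0`, `d₂ < d₀`, `d₂ < d₁`) OR a dominated contracting plane (`d₀, d₁ < 0`, `d₀, d₁ < d₂`) ⇒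
`volume {x | ∃ z ∈ Kset, Φ_s x → z} = 0`. [cite: Robinson1999, Ch. V §5.10.1 (cone estimate, dominated form; proved in the tree)] -/
theorem volume_setOf_tendsto_flow_atBot_mem_eq_zero_of_thinBlock (hV : ContDiff ℝ ∞ V) {K : ℝ}
    (hK : ∀ y, ‖fderiv ℝ V y‖ ≤ K) {Kset : Set (EuclideanSpace ℝ (Fin 3))} (hKc : IsCompact Kset)
    (hKN : Kset ⊆ selfSimilarNodalSet γ 0 V)
    (hblock : ∀ z ∈ Kset, ∃ (b : Module.Basis (Fin 3) ℝ (EuclideanSpace ℝ (Fin 3))) (lam : Fin 3 → ℝ) (β : ℝ),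
      (γ • ContinuousLinearMap.id ℝ (EuclideanSpace ℝ (Fin 3)) + fderiv ℝ V z) (b 0) = lam 0 • b 0 - β • b 1 ∧
      (γ • ContinuousLinearMap.id ℝ (EuclideanSpace ℝ (Fin 3)) + fderiv ℝ V z) (b 1) = β • b 0 + lam 1 • b 1 ∧
      (γ • ContinuousLinearMap.id ℝ (EuclideanSpace ℝ (Fin 3)) + fderiv ℝ V z) (b 2) = lam 2 • b 2 ∧
      ((lam 2 < 0 ∧ lam 2 < lam 0 ∧ lam 2 < lam 1) ∨ (lam 0 < 0 ∧ lam 1 < 0 ∧ lam 0 < lam 2 ∧ lam 1 < lam 2))) :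
    volume {x : EuclideanSpace ℝ (Fin 3) | ∃ z ∈ Kset,
      Tendsto (fun s => ODE.evolutionMap (fun _ : ℝ => selfSimilarTransport γ 0 V) 0 s x) atBot (𝓝 z)} = 0 := by
  refine volume_setOf_tendsto_flow_atBot_mem_eq_zero_of_trappedSets hV hK hKc fun z hz => ?_
  obtain ⟨b, lam, β, hA0, hA1, hA2, hshape⟩ := hblock z hz
  rcases hshape with ⟨h2, h20, h21⟩ | ⟨h0, h1, h02, h12⟩
  · exact exists_trappedSet_null_of_dominatedBlock hV hK (hKN hz) b lam β hA0 hA1 hA2 h2 h20 h21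
  · exact exists_trappedSet_null_of_contractingPlane hV hK (hKN hz) b lam β hA0 hA1 hA2 h0 h1 h02 h12

/-- **EXCLUSION, EITHER THIN SHAPE AT THE BAD NODES.**  Let `(V, P)` be a classical self-similar Euler profile, `V`
smooth, `0 < γ < ½`, with the far-field bounds (3.8).  Assume (i) an open `U ⊇ 𝒩_W` carries a `C¹` drift coordinate
`f` (`‖Df(y)W(y)‖ ≤ C‖W(y)‖²` on `U`) injective on `𝒩_W`, and (ii) at every BAD node (`1 ≤ ⟪DV(z)w,w⟫` for a unit
`w`) the linearisation `γI + DV(z)` has a real block form with a dominated contracting line OR a dominated contracting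
plane (both available at every bad node with semisimple linearisation, by `tr DW = 3γ < 1 + γ`).  Then `V ≡ 0`.
[cite: ConstantinIgnatovaVicol2026Putative, §3.5 Thm 3.10 (strengthened to stagnation continua with drift control); Robinson1999, Ch. V §5.10.1] -/
theorem eq_zero_of_driftCoordinate_of_thinBlock_on_badSet (hV : ContDiff ℝ ∞ V)
    (hprof : IsSelfSimilarEulerProfile γ 0 V P) (hγ : 0 < γ) (hγ2 : γ < 1 / 2)
    {C₀ : ℝ} (hfar : HasSelfSimilarFarFieldWith γ 0 C₀ V)
    (hblock : ∀ z ∈ selfSimilarNodalSet γ 0 V,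
      (∃ w : EuclideanSpace ℝ (Fin 3), ‖w‖ = 1 ∧ 1 ≤ ⟪fderiv ℝ V z w, w⟫) →
      ∃ (b : Module.Basis (Fin 3) ℝ (EuclideanSpace ℝ (Fin 3))) (lam : Fin 3 → ℝ) (β : ℝ),
        (γ • ContinuousLinearMap.id ℝ (EuclideanSpace ℝ (Fin 3)) + fderiv ℝ V z) (b 0) = lam 0 • b 0 - β • b 1 ∧
        (γ • ContinuousLinearMap.id ℝ (EuclideanSpace ℝ (Fin 3)) + fderiv ℝ V z) (b 1) = β • b 0 + lam 1 • b 1 ∧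
        (γ • ContinuousLinearMap.id ℝ (EuclideanSpace ℝ (Fin 3)) + fderiv ℝ V z) (b 2) = lam 2 • b 2 ∧
        ((lam 2 < 0 ∧ lam 2 < lam 0 ∧ lam 2 < lam 1) ∨ (lam 0 < 0 ∧ lam 1 < 0 ∧ lam 0 < lam 2 ∧ lam 1 < lam 2)))
    {U : Set (EuclideanSpace ℝ (Fin 3))} (hU : IsOpen U) (hNU : selfSimilarNodalSet γ 0 V ⊆ U)
    {F' : Type*} [NormedAddCommGroup F'] [NormedSpace ℝ F'] [CompleteSpace F']
    {f : EuclideanSpace ℝ (Fin 3) → F'} (hf : ContDiff ℝ 1 f) {C : ℝ}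
    (hdrift : ∀ y ∈ U, ‖fderiv ℝ f y (selfSimilarTransport γ 0 V y)‖ ≤ C * ‖selfSimilarTransport γ 0 V y‖ ^ 2)
    (hinj : InjOn f (selfSimilarNodalSet γ 0 V)) :
    V = 0 := by
  set Φ := ODE.evolutionMap (fun _ : ℝ => selfSimilarTransport γ 0 V) 0 with hΦ
  have hK : ∀ y, ‖fderiv ℝ V y‖ ≤ C₀ := norm_fderiv_le_const_of_farField hγ hfar
  have hM : ∀ y, ‖V y‖ ≤ C₀ := norm_le_const_of_farField hγ (by linarith) hfar
  have hP : ∀ y, P y ≤ P 0 + C₀ * (1 + C₀) * (γ / (1 - 2 * γ)) :=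
    hprof.pressure_le_of_hasSelfSimilarFarFieldWith hγ hγ2 hfar
  have hinj' : InjOn f (selfSimilarNodalSet γ 0 V ∩ U) := hinj.mono inter_subset_left
  have hLip := lipschitzWith_selfSimilarTransport (γ := γ) hV hK
  -- the bad set and its null basin
  set B : Set (EuclideanSpace ℝ (Fin 3)) := {z | z ∈ selfSimilarNodalSet γ 0 V ∧
    ∃ w : EuclideanSpace ℝ (Fin 3), ‖w‖ = 1 ∧ 1 ≤ ⟪fderiv ℝ V z w, w⟫} with hB
  have hnull := volume_setOf_tendsto_flow_atBot_mem_eq_zero_of_thinBlock hV hK (Kset := B)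
    (isCompact_badNodalSet hV hγ hfar) (fun _ hz => hz.1) (fun z hz => hblock z hz.1 hz.2)
  have hsub : {x : EuclideanSpace ℝ (Fin 3) | curl V x ≠ 0} ⊆ {x : EuclideanSpace ℝ (Fin 3) | ∃ z ∈ B,
      Tendsto (fun s => Φ s x) atBot (𝓝 z)} := by
    intro x hx
    have hclU : ∀ z, MapClusterPt z atBot (fun s => Φ s x) → z ∈ U := fun z hz =>
      hNU (mem_nodalSet_of_mapClusterPt_atBot hV hK hprof hM hP hγ hγ2 hz)
    obtain ⟨z, hzN, hz⟩ := tendsto_flow_atBot_of_driftCoordinate hV hK hprof hM hP hγ hγ2 x hU hclU hf hdrift hinj'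
    obtain ⟨z', hz'N, hcl', hbad', -⟩ :=
      NodalContinuum.exists_badNode_mapClusterPt_of_curl_ne_zero hprof hγ (ne_of_lt hγ2) hfar hLip hx
    have hcl : MapClusterPt z' atBot (fun s => Φ s x) := by
      have e : (fun t : ℝ => ODE.lipschitzFlow hLip x (-t)) = (fun s => Φ s x) ∘ Neg.neg := by
        funext t
        simp only [Function.comp_apply, hΦ, ODE.evolutionMap_const_zero_eq_lipschitzFlow hLip]
      rw [e, mapClusterPt_comp, Filter.map_neg_atTop] at hcl'
      exact hcl'
    have hzz' : z' = z := eq_of_nhds_neBot (hcl.clusterPt.mono hz)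
    exact ⟨z, ⟨hzN, hzz' ▸ hbad'⟩, hz⟩
  have hopen : IsOpen {x : EuclideanSpace ℝ (Fin 3) | curl V x ≠ 0} := by
    have hV2 : ContDiff ℝ 2 V := hV.of_le (by norm_cast)
    exact isOpen_ne_fun (differentiable_curl_of_contDiff hV2).continuous continuous_const
  have hzero : volume {x : EuclideanSpace ℝ (Fin 3) | curl V x ≠ 0} = 0 := measure_mono_null hsub hnull
  have hempty : {x : EuclideanSpace ℝ (Fin 3) | curl V x ≠ 0} = ∅ := (hopen.measure_eq_zero_iff volume).1 hzero
  have hcurl : ∀ x, curl V x = 0 := by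
    intro x
    by_contra hx
    have : x ∈ ({x : EuclideanSpace ℝ (Fin 3) | curl V x ≠ 0} : Set _) := hx
    rw [hempty] at this
    exact this
  funext y
  rw [eq_of_curl_eq_zero_of_isDivFree_of_fderiv_tendsto_zero (hV.of_le (by norm_cast)) hcurl hprof.divFree
    (hfar.tendsto_norm_fderiv hγ) y 0, hfar.apply_center]
  rfl

end Summit.NavierStokesRegularity.NavierStokesRegularity.Theorems.PowerGaugeEulerLiouville.Kelvin

end
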